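import Mathlib
import Summits.Ventures.PercRepro2.Defs
import Summits.Ventures.PercRepro2.Graph
import Summits.Ventures.PercRepro2.Events
import Summits.Ventures.PercRepro2.Harris
import Summits.Ventures.PercRepro2.HCov
import Summits.Ventures.PercRepro2.PendantRoot
import Summits.Ventures.PercRepro2.HCovDiag

/-!
# (HCOV) when `o` is a leaf at `b` (blind cell PercRepro2, mine-2 g13; MINE2-CUTVERTEX.md §13.22)

With `o` a leaf attached to `b` by the edge `f` of weight `q = p f`, every `o`-mass of `Gc` is `q`
times the corresponding mass with `o := b` (`{x ↔ o} = {f open} ∩ {x ↔ b}`, `PendantRoot.connEvent_other_leaf`,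
and `{f open}` is independent of the `o`-free events), and `Gc` is linear in the `o`-masses; hence
`Gc(o leaf at b) = q · Gc(o := b)` (`Gc_pendant_o_at_b`) and (HCOV) follows from the diagonal
theorem `HCovDiag.Gc_diag_nonneg` for every leaf weight (`HCov_pendant_o_at_b`).
-/

namespace Summit.Ventures.PercRepro2
namespace PendantOB

open CovForm PendantRoot

variable {V : Type*} {E : Type*} [Fintype E] [DecidableEq E] [DecidableEq V]
  {R : Type*} [Field R] [LinearOrder R] [IsStrictOrderedRing R]

omit [Fintype E] [DecidableEq E] [DecidableEq V] in
/-- Free events are closed under union. -/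
lemma free_union {f : E} {A B : Set (Config E)} (hA : Free f A) (hB : Free f B) : Free f (A ∪ B) := by
  have := dependsOn_union hA hB
  rwa [Set.union_self] at this

omit [DecidableEq V] [LinearOrder R] [IsStrictOrderedRing R] in
/-- `P(W ∩ {x ↔ o}) = q · P(W ∩ {x ↔ b})` for `o` a leaf at `b` and `W` free of `f`. -/
lemma prob_leaf1 (p : E → R) {ends : E → Sym2 V} {f : E} {o b : V} (hf : ends f = s(o, b))
    (hleaf : ∀ e, o ∈ ends e → e = f) (hob : o ≠ b) {x : V} (hx : o ≠ x) {W : Set (Config E)}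
    (hW : Free f W) :
    prob p (W ∩ connEvent ends x o) = p f * prob p (W ∩ connEvent ends x b) := by
  rw [connEvent_other_leaf hf hleaf hob hx]
  have e : W ∩ (openEdge f ∩ connEvent ends x b) = (W ∩ connEvent ends x b) ∩ openEdge f := by
    ext ω; simp only [Set.mem_inter_iff]; tauto
  rw [e, prob_inter_openEdge_of_free p (hW.inter (free_connEvent hf hleaf hob (Ne.symm hx) (Ne.symm hob))),
    mul_comm]

omit [DecidableEq V] [LinearOrder R] [IsStrictOrderedRing R] in
/-- `P(W ∩ ({x ↔ o} ∩ Y)) = q · P(W ∩ ({x ↔ b} ∩ Y))` for `W`, `Y` free of `f`. -/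
lemma prob_leaf2 (p : E → R) {ends : E → Sym2 V} {f : E} {o b : V} (hf : ends f = s(o, b))
    (hleaf : ∀ e, o ∈ ends e → e = f) (hob : o ≠ b) {x : V} (hx : o ≠ x) {W Y : Set (Config E)}
    (hW : Free f W) (hY : Free f Y) :
    prob p (W ∩ (connEvent ends x o ∩ Y)) = p f * prob p (W ∩ (connEvent ends x b ∩ Y)) := by
  rw [connEvent_other_leaf hf hleaf hob hx]
  have e : W ∩ (openEdge f ∩ connEvent ends x b ∩ Y) = (W ∩ (connEvent ends x b ∩ Y)) ∩ openEdge f := by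
    ext ω; simp only [Set.mem_inter_iff]; tauto
  rw [e, prob_inter_openEdge_of_free p
    (hW.inter ((free_connEvent hf hleaf hob (Ne.symm hx) (Ne.symm hob)).inter hY)), mul_comm]

omit [DecidableEq V] in
/-- **`Gc` with `o` a leaf at `b` is `q · Gc(o := b)`.** -/
theorem Gc_pendant_o_at_b (p : E → R) (ends : E → Sym2 V) {f : E} {o b : V} (hf : ends f = s(o, b))
    (hleaf : ∀ e, o ∈ ends e → e = f) (hob : o ≠ b) {a₁ a₂ a₃ : V} (ho1 : o ≠ a₁) (ho2 : o ≠ a₂)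
    (ho3 : o ≠ a₃) :
    Gc p ends o a₁ a₂ a₃ b = p f * Gc p ends b a₁ a₂ a₃ b := by
  have c₁₂ := free_connEvent hf hleaf hob (Ne.symm ho1) (Ne.symm ho2)
  have c₂₁ := free_connEvent hf hleaf hob (Ne.symm ho2) (Ne.symm ho1)
  have c₁₃ := free_connEvent hf hleaf hob (Ne.symm ho1) (Ne.symm ho3)
  have c₂₃ := free_connEvent hf hleaf hob (Ne.symm ho2) (Ne.symm ho3)
  have c₃₁ := free_connEvent hf hleaf hob (Ne.symm ho3) (Ne.symm ho1)
  have c₃₂ := free_connEvent hf hleaf hob (Ne.symm ho3) (Ne.symm ho2)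
  have c₁b := free_connEvent hf hleaf hob (Ne.symm ho1) (Ne.symm hob)
  have c₂b := free_connEvent hf hleaf hob (Ne.symm ho2) (Ne.symm hob)
  have hQ : Free f (avoidAll ends a₂ {a₁}) := by
    rw [avoidAll_eq_compl]; exact c₁₂.compl
  have hT : Free f (TEvent ends a₁ a₂ a₃) := c₂₁.compl.inter c₂₃
  have hTp : Free f (TEvent ends a₂ a₁ a₃) := c₁₂.compl.inter c₁₃
  have hPD : Free f (PDEvent ends a₁ a₂ a₃) := c₁₂.compl.inter ((free_union c₃₁ c₃₂).compl)
  unfold Gc DEF CovForm.EQbo EQb3 EQb3o EQo EQ3 EQ3o PDb PDbo Do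
  rw [gap_eq_Q]
  simp only [
    prob_leaf1 p hf hleaf hob ho1 hQ,
    prob_leaf2 p hf hleaf hob ho1 hQ c₁b,
    prob_leaf2 p hf hleaf hob ho1 hQ c₂b,
    prob_leaf1 p hf hleaf hob ho2 hQ,
    prob_leaf2 p hf hleaf hob ho2 hQ c₁b,
    prob_leaf2 p hf hleaf hob ho2 hQ c₂b,
    prob_leaf1 p hf hleaf hob ho1 hPD,
    prob_leaf2 p hf hleaf hob ho1 hPD c₁b,
    prob_leaf2 p hf hleaf hob ho1 hPD c₂b,
    prob_leaf1 p hf hleaf hob ho2 hPD,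
    prob_leaf2 p hf hleaf hob ho2 hPD c₁b,
    prob_leaf2 p hf hleaf hob ho2 hPD c₂b,
    prob_leaf1 p hf hleaf hob ho1 hT,
    prob_leaf2 p hf hleaf hob ho1 hT c₁b,
    prob_leaf2 p hf hleaf hob ho1 hT c₂b,
    prob_leaf1 p hf hleaf hob ho2 hT,
    prob_leaf2 p hf hleaf hob ho2 hT c₁b,
    prob_leaf2 p hf hleaf hob ho2 hT c₂b,
    prob_leaf1 p hf hleaf hob ho1 hTp,
    prob_leaf2 p hf hleaf hob ho1 hTp c₁b,
    prob_leaf2 p hf hleaf hob ho1 hTp c₂b,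
    prob_leaf1 p hf hleaf hob ho2 hTp,
    prob_leaf2 p hf hleaf hob ho2 hTp c₁b,
    prob_leaf2 p hf hleaf hob ho2 hTp c₂b]
  ring

/-- **(HCOV) when `o` is a leaf at `b`**, for every leaf weight. -/
theorem HCov_pendant_o_at_b (p : E → R) (hp : IsProbVec p) (ends : E → Sym2 V) {f : E} {o b : V}
    (hf : ends f = s(o, b)) (hleaf : ∀ e, o ∈ ends e → e = f) (hob : o ≠ b) {a₁ a₂ a₃ : V}
    (ho1 : o ≠ a₁) (ho2 : o ≠ a₂) (ho3 : o ≠ a₃) : HCov p ends o a₁ a₂ a₃ b := by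
  unfold HCov
  rw [Gc_pendant_o_at_b p ends hf hleaf hob ho1 ho2 ho3]
  exact mul_nonneg (hp.nonneg f) (HCovDiag.Gc_diag_nonneg p hp ends a₁ a₂ a₃ b)

end PendantOB
end Summit.Ventures.PercRepro2
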